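import Literature.AlgebraicGeometry.HodgeTheory.HodgeStructureOfHodgeModel
import Literature.AlgebraicGeometry.HodgeTheory.ClassesSupportedOn
import Literature.AlgebraicGeometry.Motives.HodgeStructureSubstructures
import HarnessLib

/-!
# The classes supported on a closed subset are the complexification of the rational ones

Family `hodge`, layer `Literature/AlgebraicGeometry/HodgeTheory`. A carrier-level complement to
`HodgeStructureOfHodgeModel` (the complexification `ofRatClassBaseChange : Hᵏ(Y; ℚ) ⊗_ℚ ℂ → Hᵏ(Y; ℂ)`,
`c ⊗ a ↦ c • (a ⊗ 1)`, injective for every space and onto for a smooth projective variety — universal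
coefficients, Voisin I §7.1.1) and to `ClassesSupportedOn` (`classesSupportedOn X Z i =
ker (Hⁱ(X(ℂ); ℂ) → Hⁱ((X ∖ Z)(ℂ); ℂ))`, the generators of Grothendieck's coniveau filtration):

* `ofRatClassBaseChange_ofRat` (`β(1 ⊗ a) = a ⊗ 1`), `map_ofRatClassBaseChange` (naturality of `β`
  for continuous maps, from `Motives.ofRatClass_map`), and for `X` smooth projective the linear
  equivalence `ofRatClassBaseChangeEquiv hX k : Hᵏ(X(ℂ); ℚ) ⊗ ℂ ≃ Hᵏ(X(ℂ); ℂ)` with its inverse on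
  rational classes (`ofRatClassBaseChangeEquiv_symm_ofRatClass`);
* `ratClassesSupportedOn X Z i = ker (Hⁱ(X(ℂ); ℚ) → Hⁱ((X ∖ Z)(ℂ); ℚ))` — the RATIONAL classes
  supported on `Z ⊆ X` (the generators of `Motives.coniveau`), with `_mono`, `_univ`, `_empty`;
* **`map_baseChange_ratClassesSupportedOn`**: for `X` smooth projective,
  `β ((Hⁱ_Z)_ℚ ⊗ ℂ) = classesSupportedOn X Z i` — the complex kernel of restriction to `(X ∖ Z)(ℂ)`
  is the complexification of the rational kernel (Grothendieck 1969, p. 299: `Filt'` with complex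
  coefficients is the complexification of the rational one). Proof: `⊆` by naturality; `⊇`: a
  complex class `c = β(t)` dies on `(X ∖ Z)(ℂ)` iff `β_{X∖Z}((res ⊗ 1) t) = 0` iff `(res ⊗ 1) t = 0`
  (`β` is injective for the open complement too) iff `t ∈ (ker res) ⊗ ℂ` (flatness of `ℂ/ℚ`,
  `Motives.HodgeStructure.mem_baseChange_ker_iff`);
* `finiteDimensional_bettiCohomology` (instance form of `finite_singularCohomology_rat_complexPoints`).

Consumers: `HodgeStructureOfHodgeModelSubHodge` (the kernels of restriction as sub-Hodge
structures of `HodgeModel.hodgeStructure`, given Deligne's theorem) and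
`SaitoGrFDeRhamCurveNetClassical` (the classical anchor of a curve net).

## References

* [HatcherAT2002] A. Hatcher, Algebraic Topology, CUP 2002, §3.1 p. 198 (change of coefficients).
* [VoisinHodgeI2002] C. Voisin, Hodge Theory and Complex Algebraic Geometry I, CUP 2002, §7.1.1.
* [GrothendieckTopology1969] A. Grothendieck, Hodge's general conjecture is false for trivial
  reasons, Topology 8 (1969), §1, p. 299.
-/

noncomputable section

open scoped TensorProduct
open CategoryTheory AlgebraicGeometry
open Literature.AlgebraicTopology.SingularHomology
open Literature.AlgebraicGeometry.Motives (ofRatClassBaseChange ofRatClassBaseChange_tmul)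

namespace Literature.AlgebraicGeometry.HodgeTheory

section HodgeTheory

/-! ### Complements on the complexification `β = ofRatClassBaseChange` -/

section Complexification

universe u

variable (Y : Type u) [TopologicalSpace Y] (k : ℕ)

/-- `β (1 ⊗ a) = a ⊗ 1`: on rational vectors the complexification is the rational lattice map
`ofRatClass`. [cite: HatcherAT2002, §3.1 p. 198] -/
theorem ofRatClassBaseChange_ofRat (a : singularCohomology ℚ ℚ Y k) :
    ofRatClassBaseChange Y k (Motives.HodgeStructure.ofRat a) = ofRatClass Y k a := by
  rw [Motives.HodgeStructure.ofRat_apply, ofRatClassBaseChange_tmul, one_smul]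

/-- **Naturality of `β` for continuous maps**: for `g : Y' → Y`, `g^* (β t) = β ((g^* ⊗ 1) t)`
(the rational lattice map commutes with pull-backs, `Motives.ofRatClass_map`).
[cite: HatcherAT2002, §3.1 p. 198] -/
theorem map_ofRatClassBaseChange {Y' : Type u} [TopologicalSpace Y'] (g : C(Y', Y))
    (t : ℂ ⊗[ℚ] singularCohomology ℚ ℚ Y k) :
    singularCohomology.map ℂ ℂ g k (ofRatClassBaseChange Y k t) =
      ofRatClassBaseChange Y' k ((singularCohomology.map ℚ ℚ g k).hom.baseChange ℂ t) := by
  induction t using TensorProduct.induction_on with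
  | zero => simp only [map_zero]
  | tmul a x =>
    rw [LinearMap.baseChange_tmul, ofRatClassBaseChange_tmul, ofRatClassBaseChange_tmul, map_smul]
    congr 1
    exact (Motives.ofRatClass_map k g x).symm
  | add s t hs ht => simp only [map_add, hs, ht]

end Complexification

/-! ### `β` for a smooth projective variety: the equivalence, and the kernels of restriction -/

section SmoothProjective

variable {n : ℕ} {X : Motives.SchemeOver ℂ}

/-- **The identification `β : Hᵏ(X(ℂ); ℚ) ⊗ ℂ ≃ Hᵏ(X(ℂ); ℂ)`** for `X` smooth projective
(`ofRatClassBaseChange_injective`, `ofRatClassBaseChange_surjective`; Voisin I §7.1.1: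
"`Hᵏ(X, ℚ) ⊗ ℂ = Hᵏ(X, ℂ)`"). The complexification `HodgeModel.complexification A hX k` of a
Hodge model is this followed by the pull-back to the model. [cite: VoisinHodgeI2002, §7.1.1] -/
def ofRatClassBaseChangeEquiv (hX : Motives.IsSmoothProjective n X) (k : ℕ) :
    ℂ ⊗[ℚ] Motives.bettiCohomology X k ≃ₗ[ℂ] complexBetti X k :=
  LinearEquiv.ofBijective (ofRatClassBaseChange (Motives.ComplexPoints X) k)
    ⟨ofRatClassBaseChange_injective _ k, ofRatClassBaseChange_surjective hX k⟩

/-- The equivalence is `β` on vectors. [folklore] -/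
@[simp]
theorem ofRatClassBaseChangeEquiv_apply (hX : Motives.IsSmoothProjective n X) (k : ℕ)
    (t : ℂ ⊗[ℚ] Motives.bettiCohomology X k) :
    ofRatClassBaseChangeEquiv hX k t = ofRatClassBaseChange (Motives.ComplexPoints X) k t :=
  rfl

/-- The inverse equivalence sends a rational class `a ⊗ 1` to `1 ⊗ a`. [cite: VoisinHodgeI2002, §7.1.1] -/
theorem ofRatClassBaseChangeEquiv_symm_ofRatClass (hX : Motives.IsSmoothProjective n X) (k : ℕ)
    (a : Motives.bettiCohomology X k) :
    (ofRatClassBaseChangeEquiv hX k).symm (ofRatClass (Motives.ComplexPoints X) k a) =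
      Motives.HodgeStructure.ofRat a := by
  rw [LinearEquiv.symm_apply_eq, ofRatClassBaseChangeEquiv_apply, ofRatClassBaseChange_ofRat]

/-- The complexification of a Hodge model factors through the equivalence:
`Θ_A = (pull-back) ∘ β`. [folklore] -/
theorem HodgeModel.complexification_eq_trans (A : HodgeModel n X)
    (hX : Motives.IsSmoothProjective n X) (k : ℕ) :
    A.complexification hX k = (ofRatClassBaseChangeEquiv hX k).trans (A.pullbackEquiv k) :=
  rfl

variable (X) in
/-- The rational classes of `Hⁱ(X(ℂ); ℚ)` **supported on** `Z ⊆ X`: the kernel of the restriction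
`Hⁱ(X(ℂ); ℚ) → Hⁱ((X ∖ Z)(ℂ); ℚ)` (the generators of Grothendieck's coniveau filtration
`Motives.coniveau`; the rational form of `classesSupportedOn`). [cite: GrothendieckTopology1969, §1] -/
def ratClassesSupportedOn (Z : Set X.left) (i : ℕ) : Submodule ℚ (Motives.bettiCohomology X i) :=
  LinearMap.ker (Motives.bettiCohomology.restrictCompl X Z i).hom

/-- Unfolding: `x` is supported on `Z` iff its restriction to `(X ∖ Z)(ℂ)` vanishes.
[cite: GrothendieckTopology1969, §1] -/
@[simp]
theorem mem_ratClassesSupportedOn_iff {Z : Set X.left} {i : ℕ} {x : Motives.bettiCohomology X i} :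
    x ∈ ratClassesSupportedOn X Z i ↔ Motives.bettiCohomology.restrictCompl X Z i x = 0 :=
  LinearMap.mem_ker

/-- Restriction to the smaller open set `(X ∖ Z')(ℂ)` factors through restriction to `(X ∖ Z)(ℂ)`
for `Z ⊆ Z'` (rational coefficients; functoriality of `Hⁱ`). [folklore] -/
theorem bettiRestrictCompl_eq_comp {Z Z' : Set X.left} (h : Z ⊆ Z') (i : ℕ) :
    Motives.bettiCohomology.restrictCompl X Z' i =
      Motives.bettiCohomology.restrictCompl X Z i ≫
        singularCohomology.map ℚ ℚ (complexPointsComplInclusion h) i := by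
  rw [← singularCohomology.map_comp]
  rfl

/-- Monotonicity in the support (rational coefficients): `Z ⊆ Z' ⇒ Hⁱ_Z ≤ Hⁱ_{Z'}`.
[cite: GrothendieckTopology1969, §1] -/
theorem ratClassesSupportedOn_mono {Z Z' : Set X.left} (h : Z ⊆ Z') (i : ℕ) :
    ratClassesSupportedOn X Z i ≤ ratClassesSupportedOn X Z' i := by
  intro x hx
  rw [mem_ratClassesSupportedOn_iff] at hx ⊢
  rw [bettiRestrictCompl_eq_comp h i, ModuleCat.comp_apply, hx, map_zero]

variable (X) in
/-- Every rational class is supported on `Z = X` (`(X ∖ X)(ℂ) = ∅`). [cite: GrothendieckTopology1969, §1] -/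
theorem ratClassesSupportedOn_univ (i : ℕ) : ratClassesSupportedOn X Set.univ i = ⊤ := by
  refine eq_top_iff.2 fun x _ ↦ mem_ratClassesSupportedOn_iff.mpr ?_
  haveI : IsEmpty (Motives.complexPointsCompl X Set.univ) := ⟨fun P ↦ P.2 (Set.mem_univ _)⟩
  haveI := ModuleCat.subsingleton_of_isZero
    (Motives.isZero_singularCohomology_of_isEmpty ℚ ℚ (E := Motives.complexPointsCompl X Set.univ) i)
  exact Subsingleton.elim _ _

variable (X) in
/-- Only `0` is supported on `∅` (restriction to `(X ∖ ∅)(ℂ) ≃ₜ X(ℂ)` is an isomorphism).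
[cite: GrothendieckTopology1969, §1] -/
theorem ratClassesSupportedOn_empty (i : ℕ) : ratClassesSupportedOn X ∅ i = ⊥ := by
  refine eq_bot_iff.2 fun x hx ↦ ?_
  rw [mem_ratClassesSupportedOn_iff] at hx
  have hiso : Motives.bettiCohomology.restrictCompl X ∅ i =
      (singularCohomology.mapIso ℚ ℚ (complexPointsComplEmptyHomeomorph X) i).hom := rfl
  rw [hiso] at hx
  have h := CategoryTheory.Iso.hom_inv_id_apply
    (singularCohomology.mapIso ℚ ℚ (complexPointsComplEmptyHomeomorph X) i) x
  rw [hx, map_zero] at h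
  exact (Submodule.mem_bot ℚ).2 h.symm

/-- Rational classes supported on `Z` complexify to classes supported on `Z`:
`β ((Hⁱ_Z)_ℚ ⊗ ℂ) ≤ Hⁱ_Z` (naturality of `β`). [cite: HatcherAT2002, §3.1 p. 198] -/
theorem map_baseChange_ratClassesSupportedOn_le (Z : Set X.left) (i : ℕ) :
    ((ratClassesSupportedOn X Z i).baseChange ℂ).map (ofRatClassBaseChange (Motives.ComplexPoints X) i) ≤
      classesSupportedOn X Z i := by
  rw [Submodule.baseChange_eq_span, Submodule.map_span, Submodule.span_le]
  rintro _ ⟨_, ⟨v, hv, rfl⟩, rfl⟩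
  rw [SetLike.mem_coe, mem_classesSupportedOn_iff]
  have hv' : (singularCohomology.map ℚ ℚ
      (⟨Subtype.val, continuous_subtype_val⟩ :
        C(Motives.complexPointsCompl X Z, Motives.ComplexPoints X)) i).hom v = 0 :=
    mem_ratClassesSupportedOn_iff.mp hv
  change singularCohomology.map ℂ ℂ _ i
      (ofRatClassBaseChange (Motives.ComplexPoints X) i ((TensorProduct.mk ℚ ℂ _ 1) v)) = 0
  rw [TensorProduct.mk_apply, map_ofRatClassBaseChange, LinearMap.baseChange_tmul, hv',
    TensorProduct.tmul_zero, map_zero]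

/-- **The complex classes supported on `Z` are the complexification of the rational ones**, for
`X` smooth projective: `β ((Hⁱ_Z)_ℚ ⊗ ℂ) = Hⁱ_Z = classesSupportedOn X Z i`. `⊇`: a complex class
`c = β(t)` killed by restriction to `(X ∖ Z)(ℂ)` has `β_{X∖Z}((res ⊗ 1) t) = 0`, hence
`(res ⊗ 1) t = 0` (`β` is injective for the open complement, `ofRatClassBaseChange_injective`),
hence `t ∈ (ker res) ⊗ ℂ` (flatness of `ℂ/ℚ`, `Motives.HodgeStructure.mem_baseChange_ker_iff`).
[cite: VoisinHodgeI2002, §7.1.1] [cite: GrothendieckTopology1969, §1, p. 299] -/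
theorem map_baseChange_ratClassesSupportedOn (hX : Motives.IsSmoothProjective n X)
    (Z : Set X.left) (i : ℕ) :
    ((ratClassesSupportedOn X Z i).baseChange ℂ).map (ofRatClassBaseChange (Motives.ComplexPoints X) i) =
      classesSupportedOn X Z i := by
  refine le_antisymm (map_baseChange_ratClassesSupportedOn_le Z i) fun c hc ↦ ?_
  obtain ⟨t, rfl⟩ := ofRatClassBaseChange_surjective hX i c
  refine ⟨t, ?_, rfl⟩
  rw [SetLike.mem_coe, ratClassesSupportedOn, Motives.HodgeStructure.mem_baseChange_ker_iff]
  apply ofRatClassBaseChange_injective (Motives.complexPointsCompl X Z) i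
  rw [map_zero, ← map_ofRatClassBaseChange]
  exact mem_classesSupportedOn_iff.mp hc

/-- The same identification through the equivalence `β : Hⁱ(X(ℂ); ℚ) ⊗ ℂ ≃ Hⁱ(X(ℂ); ℂ)`.
[cite: VoisinHodgeI2002, §7.1.1] -/
theorem map_baseChange_ratClassesSupportedOn_equiv (hX : Motives.IsSmoothProjective n X)
    (Z : Set X.left) (i : ℕ) :
    ((ratClassesSupportedOn X Z i).baseChange ℂ).map (ofRatClassBaseChangeEquiv hX i).toLinearMap =
      classesSupportedOn X Z i :=
  map_baseChange_ratClassesSupportedOn hX Z i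

/-- **The complex classes supported on `Z` are spanned by the rational ones** (restatement on the
complex carrier: `classesSupportedOn X Z i` is the `ℂ`-span of its rational classes; the tree's
`ker_restrictCompl_le_span`, universal coefficients). [cite: GrothendieckTopology1969, §1, p. 299] -/
theorem span_rational_classesSupportedOn (hX : Motives.IsSmoothProjective n X) (Z : Set X.left)
    (i : ℕ) :
    Submodule.span ℂ {x : complexBetti X i |
        IsRationalClass x ∧ complexBetti.restrictCompl X Z i x = 0} =
      classesSupportedOn X Z i :=
  le_antisymm (Submodule.span_le.2 fun _ hc ↦ mem_classesSupportedOn_iff.2 hc.2)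
    (span_isRationalClass_eq_top_of_isSmoothProjective.ker_restrictCompl_le_span
      span_isRationalClass_eq_top_of_isSmoothProjective_holds hX Z i)

/-- Finite-dimensionality of `Hᵏ(X(ℂ); ℚ)` for `X` smooth projective, instance form of the
tree's `finite_singularCohomology_rat_complexPoints`. [cite: VoisinHodgeI2002, §7.1.1] -/
theorem finiteDimensional_bettiCohomology (hX : Motives.IsSmoothProjective n X) (k : ℕ) :
    FiniteDimensional ℚ (Motives.bettiCohomology X k) :=
  finite_singularCohomology_rat_complexPoints hX k

end SmoothProjective

end HodgeTheory

end Literature.AlgebraicGeometry.HodgeTheory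

end
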